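import Summits.NavierStokesRegularity.NavierStokesRegularity.Theorems.MonotonePressureProfileRigidity.Negative.LoadBearing
import Literature.Analysis.FluidPDE.HarmonicLiouvilleSublinear

/-!
# `MonotonePressureProfileRigidity` (crux K2⁺, stmt-NavierStokesRegularity-20180), LINE `birth`
# (`Cruxes/MonotonePressureProfileRigidity/Lines/birth.lean`): the Navier–Stokes hypothesis is
# load-bearing in EVERY stub (negative-side support; refuter, critic seat ns-typeII-critic-2)

The registered skeleton splits K2⁺ as `stub_smallSliceOfMonotonePressure` (L: door class ∧ shift-monotone
similarity pressure ⇒ for all `R, θ > 0` a time `t̄ < 0` with `∫_{B(0,2R√(−t̄))} |curl v(t̄)|² ≤ θ²/(4√(−t̄))`)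
followed by `stub_regularOfSmallSlices` (M: door class ∧ such slices ⇒ the apex is not backward-singular),
plus the plan-only rung `stub_rung_dssSteadyPressure` (λ-DSS, `λ > 1`, time-independent similarity pressure
⇒ regular apex).  Sorry-free record that the Oseen–Duhamel (mild) hypothesis is load-bearing in all three:

* §1 `curl (c U(c ·)) = c² (curl U)(c ·)` for the tree's `biaxProfile U` (`curl_blobSlice`); `U` is NOT
  irrotational (`exists_curl_biaxProfile_ne_zero`: a compactly supported curl- and divergence-free field is
  constant by the tree's Liouville lemma `eq_of_curl_eq_zero_of_isDivFree_of_fderiv_tendsto_zero`, yet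
  `U(½e₀) = ½e₀ ≠ 0 = U` far out), so `∫ |curl U|² ≠ 0` (`lintegral_curl_biaxProfile_sq_ne_zero`); and the
  slice functional is SCALE-INVARIANT on dilated slices: `∫_{B(0,2R/c)} |curl (c U(c ·))|² = c ∫ |curl U|²`
  once `B(0,R) ⊇ supp curl U` (`setLIntegral_curl_blobSlice_sq`).
* §2 `stub_smallSliceOfMonotonePressure_false_without_mild`: L minus the mild identity is FALSE — on the
  self-similar collapse `v(t) = blobSlice (√(−t))⁻¹` (door class minus dynamics, constant similarity
  pressure: `LoadBearing.lean`) the normalised slice enstrophy is the constant `∫ |curl U|² > 0`.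
* §3 `stub_regularOfSmallSlices_false_without_mild`: M minus the mild identity is FALSE — the time-gated
  collapse `t ↦ blobSlice (χ(2t+2)·(√(−t))⁻¹)`, `χ = Real.smoothTransition` (zero slices for `t ≤ −1`, the
  collapse itself for `−½ ≤ t < 0`), is in the door class minus dynamics, has the small slice `t̄ = −1` for
  all `R, θ`, and is backward-singular (a germ property of the slices: `isBackwardSingularPoint_zero_of_eqOn`).
* §4 `stub_rung_dssSteadyPressure_false_without_mild`: the BC5 rung minus the mild identity is FALSE for
  every `λ > 1` at once — the collapse is exactly self-similar (`isSelfSimilar_selfSimilarBlob`) with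
  time-independent similarity pressure (`similarityPressure_selfSimilarBlob`).

For the line's lead and provers: none of L, M, BC5 is a statement about kinematics, decay and a pressure
budget alone; each proof must run through the Oseen–Duhamel identity.  No stub is refuted AS TYPED (that
would need a genuine Type-I blow-up profile).

## References

* D. Chae, R. Shvydkoy, Arch. Ration. Mech. Anal. 209 (2013) 999–1017, Thm. 4.1 (proof, last paragraph:
  the curl-free/div-free Liouville step). [ChaeShvydkoy2013]
* T.-P. Tsai, Arch. Ration. Mech. Anal. 143 (1998) 29–51, Thm. 1. [Tsai1998]
* B. Pineau, V. Vicol, arXiv:2607.09619 (2026), (9.17) (the slice normalisation). [PineauVicol2026]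
-/

noncomputable section

open Set Filter Function MeasureTheory Metric
open scoped Topology ENNReal NNReal
open Literature.Analysis.FluidPDE Literature.Analysis.UnboundedOperators
open Summit.NavierStokesRegularity.NavierStokesRegularity.Theorems.FastClassSqueeze.Negative

-- the summit and its single problem share the name `NavierStokesRegularity` (D-0017 nested layout)
set_option linter.dupNamespace false

namespace Summit.NavierStokesRegularity.NavierStokesRegularity.Theorems.MonotonePressureProfileRigidity.Negative

/-! ## §1 Vorticity of the profile and of its dilated slices -/

/-- `curl (c U(c ·))(x) = c² (curl U)(c x)` (chain rule `fderiv_blobSlice` and linearity of `curl` in the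
Jacobian). [folklore] -/
theorem curl_blobSlice (c : ℝ) (x : EuclideanSpace ℝ (Fin 3)) :
    curl (blobSlice c) x = (c * c) • curl biaxProfile (c • x) := by
  rw [curl_eq_curlCLM, fderiv_blobSlice, map_smul, ← curl_eq_curlCLM]

/-- `curl U` is continuous. [folklore] -/
theorem continuous_curl_biaxProfile : Continuous (curl biaxProfile) :=
  (contDiff_curl (n := 0) (by exact_mod_cast contDiff_biaxProfile (n := 1))).continuous

/-- `curl U` has compact support. [folklore] -/
theorem hasCompactSupport_curl_biaxProfile : HasCompactSupport (curl biaxProfile) :=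
  hasCompactSupport_curl hasCompactSupport_biaxProfile

/-- **The profile is not irrotational.**  A `C²`, compactly supported, curl-free and divergence-free
field on `ℝ³` is constant (tree Liouville lemma `eq_of_curl_eq_zero_of_isDivFree_of_fderiv_tendsto_zero`,
Chae–Shvydkoy 2013, proof of Thm. 4.1), whereas `U(½e₀) = ½e₀ ≠ 0` and `U` vanishes outside a ball.
[cite: ChaeShvydkoy2013, Thm. 4.1 (proof)] -/
theorem exists_curl_biaxProfile_ne_zero : ∃ x : EuclideanSpace ℝ (Fin 3), curl biaxProfile x ≠ 0 := by
  by_contra h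
  push Not at h
  have hD : Tendsto (fun y => ‖fderiv ℝ biaxProfile y‖) (cocompact (EuclideanSpace ℝ (Fin 3))) (𝓝 0) :=
    (hasCompactSupport_biaxProfile.fderiv (𝕜 := ℝ)).norm.is_zero_at_infty
  have hconst := eq_of_curl_eq_zero_of_isDivFree_of_fderiv_tendsto_zero
    (by exact_mod_cast contDiff_biaxProfile (n := 2)) h (fun x => divergence_biaxProfile x) hD
  obtain ⟨R, hR0, hR⟩ :=
    hasCompactSupport_biaxProfile.isCompact.isBounded.subset_ball_lt 0 (0 : EuclideanSpace ℝ (Fin 3))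
  have hex : ‖(ex : EuclideanSpace ℝ (Fin 3))‖ = 1 := by simp [ex]
  have hfar : biaxProfile (R • ex) = 0 := by
    refine image_eq_zero_of_notMem_tsupport fun h' => ?_
    have h'' := hR h'
    rw [mem_ball, dist_zero_right, norm_smul, Real.norm_of_nonneg hR0.le, hex, mul_one] at h''
    exact lt_irrefl _ h''
  have h1 := hconst ((1 / 2 : ℝ) • ex) (R • ex)
  rw [biaxProfile_half_ex, hfar] at h1
  have h2 : ‖(1 / 2 : ℝ) • (ex : EuclideanSpace ℝ (Fin 3))‖ = 1 / 2 := by rw [norm_smul, hex]; norm_num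
  rw [h1, norm_zero] at h2
  norm_num at h2

/-- **The profile has positive enstrophy**: `∫ |curl U|² ≠ 0`. [folklore] -/
theorem lintegral_curl_biaxProfile_sq_ne_zero :
    (∫⁻ x, ENNReal.ofReal (‖curl biaxProfile x‖ ^ 2)) ≠ 0 := by
  intro h0
  have hf : Continuous fun x : EuclideanSpace ℝ (Fin 3) => ENNReal.ofReal (‖curl biaxProfile x‖ ^ 2) :=
    ENNReal.continuous_ofReal.comp ((continuous_curl_biaxProfile.norm).pow 2)
  have hae := (lintegral_eq_zero_iff hf.measurable).1 h0
  have heq := (Continuous.ae_eq_iff_eq (μ := volume) hf continuous_zero).1 hae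
  obtain ⟨x, hx⟩ := exists_curl_biaxProfile_ne_zero
  have h1 := congrFun heq x
  simp only [Pi.zero_apply, ENNReal.ofReal_eq_zero] at h1
  exact hx (norm_eq_zero.1 (pow_eq_zero_iff two_ne_zero |>.1 (le_antisymm h1 (sq_nonneg _))))

/-- **Scale invariance of the slice functional on the dilated slices**: if `B(0, R)` holds the support of
`curl U` and `c > 0`, then `∫_{B(0, 2R c⁻¹)} |curl (c U(c ·))|² = c ∫ |curl U|²`. [folklore] -/
theorem setLIntegral_curl_blobSlice_sq {R : ℝ}
    (hR : tsupport (curl biaxProfile) ⊆ ball (0 : EuclideanSpace ℝ (Fin 3)) R) {c : ℝ} (hc : 0 < c) :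
    (∫⁻ x in ball (0 : EuclideanSpace ℝ (Fin 3)) (2 * R * c⁻¹), ENNReal.ofReal (‖curl (blobSlice c) x‖ ^ 2)) =
      ENNReal.ofReal c * ∫⁻ x, ENNReal.ofReal (‖curl biaxProfile x‖ ^ 2) := by
  have h1 : ∀ x : EuclideanSpace ℝ (Fin 3), ENNReal.ofReal (‖curl (blobSlice c) x‖ ^ 2) =
      ENNReal.ofReal ((c * c) ^ 2) * ENNReal.ofReal (‖curl biaxProfile (c • x)‖ ^ 2) := fun x => by
    rw [curl_blobSlice, norm_smul, mul_pow, Real.norm_of_nonneg (mul_self_nonneg c),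
      ENNReal.ofReal_mul (sq_nonneg _)]
  have hsupp : support (fun x : EuclideanSpace ℝ (Fin 3) => ENNReal.ofReal (‖curl (blobSlice c) x‖ ^ 2)) ⊆
      ball (0 : EuclideanSpace ℝ (Fin 3)) (2 * R * c⁻¹) := by
    intro x hx
    rw [mem_support, h1] at hx
    have hx' : curl biaxProfile (c • x) ≠ 0 := by
      intro h0
      exact hx (by rw [h0, norm_zero, zero_pow two_ne_zero, ENNReal.ofReal_zero, mul_zero])
    have hmem := hR (subset_tsupport _ (mem_support.2 hx'))
    rw [mem_ball, dist_zero_right, norm_smul, Real.norm_of_nonneg hc.le] at hmem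
    rw [mem_ball, dist_zero_right]
    have hR0 : 0 < R := lt_of_le_of_lt (by positivity) hmem
    calc ‖x‖ = c⁻¹ * (c * ‖x‖) := by field_simp
      _ < c⁻¹ * R := mul_lt_mul_of_pos_left hmem (inv_pos.2 hc)
      _ ≤ 2 * R * c⁻¹ := by nlinarith [inv_pos.2 hc]
  rw [setLIntegral_eq_of_support_subset hsupp]
  simp_rw [h1]
  rw [lintegral_const_mul' _ _ ENNReal.ofReal_ne_top,
    HomSobolevSymmetry.lintegral_comp_smul (fun x => ENNReal.ofReal (‖curl biaxProfile x‖ ^ 2)) hc,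
    ← mul_assoc, ← ENNReal.ofReal_mul (sq_nonneg _)]
  congr 2
  rw [show (c * c) ^ 2 = c * c ^ 3 by ring, mul_inv_cancel_right₀ (pow_ne_zero 3 hc.ne')]

/-! ## §2 Stub L (`stub_smallSliceOfMonotonePressure`) without the dynamics is false -/

/-- **`stub_smallSliceOfMonotonePressure` minus the mild identity is FALSE.**  Drop ONLY the
Oseen–Duhamel hypothesis `v t = e^{(t−s)Δ} v s − B¹_s(v,v)(t)` of stub L and keep the Type-I rate, the
space–time Type-I decay, joint continuity on the open past slab, `div v(t) = 0` and the shift-monotone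
similarity Riesz pressure: the conclusion "for all `R, θ > 0` some slice `t̄ < 0` has
`∫_{B(0,2R√(−t̄))} |curl v(t̄)|² ≤ θ²/(4√(−t̄))`" fails for the self-similar collapse
`v(t) = blobSlice (√(−t))⁻¹` of the `biaxProfile` (all kept hypotheses: file `LoadBearing.lean`), because
by scale invariance `√(−t̄)·∫_{B(0,2R√(−t̄))} |curl v(t̄)|² = ∫ |curl U|² > 0` for every `t̄ < 0` as soon as
`B(0,R) ⊇ supp curl U`.  Hence the head-pressure mechanism of stub L must use the Navier–Stokes dynamics.
[folklore] -/
theorem stub_smallSliceOfMonotonePressure_false_without_mild :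
    ¬ ∀ (C D : ℝ) (v : ℝ → EuclideanSpace ℝ (Fin 3) → EuclideanSpace ℝ (Fin 3)),
        HasTypeITimeDecay C v → HasTypeIDecay D v →
        ContinuousOn (uncurry v) (Iio (0 : ℝ) ×ˢ univ) →
        (∀ t < 0, VectorCalculus.IsDivFree (v t)) →
        (∀ t < 0, ∀ σ ∈ Icc (0 : ℝ) 1, ∀ y : EuclideanSpace ℝ (Fin 3),
          (-(Real.exp (-σ) * t)) *
              pressurePotential (v (Real.exp (-σ) * t)) (Real.sqrt (-(Real.exp (-σ) * t)) • y) ≤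
            (-t) * pressurePotential (v t) (Real.sqrt (-t) • y)) →
        ∀ R θ : ℝ, 0 < R → 0 < θ → ∃ tb : ℝ, tb < 0 ∧
          (∫⁻ x in ball (0 : EuclideanSpace ℝ (Fin 3)) (2 * R * Real.sqrt (-tb)),
              ENNReal.ofReal (‖curl (v tb) x‖ ^ 2)) ≤
            ENNReal.ofReal (θ ^ 2 / (4 * Real.sqrt (-tb))) := by
  intro h
  obtain ⟨Cd, hCd0, hCd⟩ := exists_decay_biaxProfile
  obtain ⟨R, hR0, hR⟩ :=
    hasCompactSupport_curl_biaxProfile.isCompact.isBounded.subset_ball_lt 0 (0 : EuclideanSpace ℝ (Fin 3))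
  have hθ : ∀ θ : ℝ, 0 < θ →
      (∫⁻ x, ENNReal.ofReal (‖curl biaxProfile x‖ ^ 2)) ≤ ENNReal.ofReal (θ ^ 2 / 4) := by
    intro θ hθ
    obtain ⟨tb, htb, hle⟩ := h Cd Cd (fun t : ℝ => blobSlice (Real.sqrt (-t))⁻¹)
      ((hasTypeIDecay_selfSimilarBlob hCd).hasTypeITimeDecay hCd0) (hasTypeIDecay_selfSimilarBlob hCd)
      continuousOn_selfSimilarBlob (fun t _ => isDivFree_blobSlice _) (pressureShift_le_selfSimilarBlob hCd)
      R θ hR0 hθ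
    have hs : 0 < Real.sqrt (-tb) := Real.sqrt_pos.2 (by linarith)
    have hc0 : 0 < (Real.sqrt (-tb))⁻¹ := inv_pos.2 hs
    have hrad : 2 * R * Real.sqrt (-tb) = 2 * R * ((Real.sqrt (-tb))⁻¹)⁻¹ := by rw [inv_inv]
    have hrhs : ENNReal.ofReal (θ ^ 2 / (4 * Real.sqrt (-tb))) =
        ENNReal.ofReal (Real.sqrt (-tb))⁻¹ * ENNReal.ofReal (θ ^ 2 / 4) := by
      rw [← ENNReal.ofReal_mul hc0.le]
      congr 1
      field_simp
    have hle' : (∫⁻ x in ball (0 : EuclideanSpace ℝ (Fin 3)) (2 * R * Real.sqrt (-tb)),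
        ENNReal.ofReal (‖curl (blobSlice (Real.sqrt (-tb))⁻¹) x‖ ^ 2)) ≤
        ENNReal.ofReal (θ ^ 2 / (4 * Real.sqrt (-tb))) := hle
    rw [hrad, setLIntegral_curl_blobSlice_sq hR hc0, hrhs] at hle'
    exact (ENNReal.mul_le_mul_iff_right ((ENNReal.ofReal_pos.2 hc0).ne') ENNReal.ofReal_ne_top).1 hle'
  refine lintegral_curl_biaxProfile_sq_ne_zero (le_antisymm ?_ zero_le)
  refine ENNReal.le_of_forall_pos_le_add fun ε hε _ => ?_
  rw [zero_add]
  have hε' : 0 < 2 * Real.sqrt (ε : ℝ) := mul_pos two_pos (Real.sqrt_pos.2 (NNReal.coe_pos.2 hε))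
  calc (∫⁻ x, ENNReal.ofReal (‖curl biaxProfile x‖ ^ 2))
        ≤ ENNReal.ofReal ((2 * Real.sqrt (ε : ℝ)) ^ 2 / 4) := hθ _ hε'
    _ = ENNReal.ofReal (ε : ℝ) := by
        congr 1
        rw [mul_pow, Real.sq_sqrt ε.coe_nonneg]
        ring
    _ = ε := ENNReal.ofReal_coe_nnreal

/-! ## §3 Stub M (`stub_regularOfSmallSlices`) without the dynamics is false: the time-gated collapse -/

/-- Space–time Type-I decay of the time-gated collapse `t ↦ blobSlice (χ(2t+2)·(√(−t))⁻¹)`,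
`χ = Real.smoothTransition ∈ [0, 1]`: a gate `0 ≤ χ ≤ 1` only improves the decay of a dilated slice.
[folklore] -/
theorem hasTypeIDecay_gatedBlob {Cd : ℝ} (hCd0 : 0 ≤ Cd)
    (hCd : ∀ y : EuclideanSpace ℝ (Fin 3), ‖biaxProfile y‖ ≤ Cd / (1 + ‖y‖)) :
    HasTypeIDecay Cd
      (fun t : ℝ => blobSlice (Real.smoothTransition (2 * t + 2) * (Real.sqrt (-t))⁻¹)) := by
  intro t ht x
  have hs : 0 < Real.sqrt (-t) := Real.sqrt_pos.2 (by linarith)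
  have hg0 : 0 ≤ Real.smoothTransition (2 * t + 2) := Real.smoothTransition.nonneg _
  have hg1 : Real.smoothTransition (2 * t + 2) ≤ 1 := Real.smoothTransition.le_one _
  show ‖blobSlice (Real.smoothTransition (2 * t + 2) * (Real.sqrt (-t))⁻¹) x‖ ≤ Cd / (‖x‖ + Real.sqrt (-t))
  rcases hg0.eq_or_lt with h0 | hpos
  · rw [← h0, zero_mul]
    show ‖(0 : ℝ) • biaxProfile ((0 : ℝ) • x)‖ ≤ _
    rw [zero_smul, norm_zero]
    positivity
  · have hκ : 0 < Real.smoothTransition (2 * t + 2) * (Real.sqrt (-t))⁻¹ := mul_pos hpos (inv_pos.2 hs)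
    refine (norm_blobSlice_le hCd hκ x).trans ?_
    have h1 : Real.sqrt (-t) ≤ (Real.smoothTransition (2 * t + 2) * (Real.sqrt (-t))⁻¹)⁻¹ := by
      rw [mul_inv, inv_inv]
      exact le_mul_of_one_le_left hs.le ((one_le_inv₀ hpos).2 hg1)
    exact div_le_div_of_nonneg_left hCd0 (by positivity) (by linarith)

/-- The time-gated collapse is jointly continuous on the open past slab. [folklore] -/
theorem continuousOn_gatedBlob :
    ContinuousOn (uncurry fun t : ℝ => blobSlice (Real.smoothTransition (2 * t + 2) * (Real.sqrt (-t))⁻¹))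
      (Iio (0 : ℝ) ×ˢ univ) := by
  have h1 : ContinuousOn (fun z : ℝ × EuclideanSpace ℝ (Fin 3) =>
      Real.smoothTransition (2 * z.1 + 2) * (Real.sqrt (-z.1))⁻¹) (Iio (0 : ℝ) ×ˢ univ) := by
    refine ContinuousOn.mul ?_ (ContinuousOn.inv₀ ?_ fun z hz => (Real.sqrt_pos.2 ?_).ne')
    · exact (Real.smoothTransition.continuous.comp
        ((continuous_const.mul continuous_fst).add continuous_const)).continuousOn
    · exact (Real.continuous_sqrt.comp (continuous_neg.comp continuous_fst)).continuousOn
    · linarith [show z.1 < 0 from hz.1]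
  have hU : Continuous biaxProfile := (contDiff_biaxProfile (n := 0)).continuous
  exact h1.smul (hU.comp_continuousOn (h1.smul continuousOn_snd))

/-- Near the apex (`−¼ < t`, so `χ(2t+2) = 1`) the time-gated collapse IS the self-similar collapse. [folklore] -/
theorem gatedBlob_eq_of_lt {t : ℝ} (ht : -(1 / 2 : ℝ) ^ 2 < t) :
    blobSlice (Real.smoothTransition (2 * t + 2) * (Real.sqrt (-t))⁻¹) = blobSlice (Real.sqrt (-t))⁻¹ := by
  rw [Real.smoothTransition.one_of_one_le (by nlinarith), one_mul]

/-- At `t = −1` (where `χ(0) = 0`) the slice of the time-gated collapse is irrotational (it is zero). [folklore] -/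
theorem curl_gatedBlob_neg_one (x : EuclideanSpace ℝ (Fin 3)) :
    curl (blobSlice (Real.smoothTransition (2 * (-1 : ℝ) + 2) * (Real.sqrt (-(-1 : ℝ)))⁻¹)) x = 0 := by
  rw [show (2 : ℝ) * -1 + 2 = 0 by norm_num, Real.smoothTransition.zero, zero_mul, curl_blobSlice, zero_mul,
    zero_smul]

/-- **Backward singularity at the apex is a germ property of the slices**: if `u t = v t` for
`−δ² < t < 0` and `v` is backward-singular at the origin, so is `u` (the cylinders `Q_{min r δ}(0,0) ⊆ Q_r(0,0)`
already carry infinite `L^∞` norm). [folklore] -/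
theorem isBackwardSingularPoint_zero_of_eqOn
    {u v : ℝ → EuclideanSpace ℝ (Fin 3) → EuclideanSpace ℝ (Fin 3)} (hv : IsBackwardSingularPoint v 0)
    {δ : ℝ} (hδ : 0 < δ) (huv : ∀ t : ℝ, -δ ^ 2 < t → t < 0 → u t = v t) :
    IsBackwardSingularPoint u 0 := by
  intro r hr
  have hm0 : 0 < min r δ := lt_min hr hδ
  have hsub : parabolicCylinder (min r δ) (0 : ℝ × EuclideanSpace ℝ (Fin 3)) ⊆ parabolicCylinder r 0 := by
    refine prod_mono (Ioo_subset_Ioo ?_ le_rfl) (ball_subset_ball (min_le_left _ _))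
    simp only [Prod.fst_zero]
    nlinarith [min_le_left r δ, hm0]
  have hQ : MeasurableSet (parabolicCylinder (min r δ) (0 : ℝ × EuclideanSpace ℝ (Fin 3))) :=
    (isOpen_parabolicCylinder _ _).measurableSet
  have hae : uncurry u =ᵐ[volume.restrict (parabolicCylinder (min r δ) (0 : ℝ × EuclideanSpace ℝ (Fin 3)))]
      uncurry v := by
    refine (ae_restrict_iff' hQ).2 (Eventually.of_forall fun z hz => ?_)
    rw [mem_parabolicCylinder] at hz
    obtain ⟨⟨h1, h2⟩, -⟩ := hz
    simp only [Prod.fst_zero, zero_sub] at h1 h2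
    have hmδ : min r δ ≤ δ := min_le_right _ _
    have ht : -δ ^ 2 < z.1 := by nlinarith
    show u z.1 z.2 = v z.1 z.2
    rw [huv z.1 ht h2]
  have h1 := hv (min r δ) hm0
  rw [← eLpNorm_congr_ae hae] at h1
  have h2 : eLpNorm (uncurry u) ∞ (volume.restrict (parabolicCylinder (min r δ) (0 : ℝ × EuclideanSpace ℝ (Fin 3)))) ≤
      eLpNorm (uncurry u) ∞ (volume.restrict (parabolicCylinder r (0 : ℝ × EuclideanSpace ℝ (Fin 3)))) :=
    eLpNorm_mono_measure _ (Measure.restrict_mono_set _ hsub)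
  rw [h1] at h2
  exact eq_top_iff.2 h2

/-- The time-gated collapse is backward-singular at the origin. [folklore] -/
theorem isBackwardSingularPoint_gatedBlob :
    IsBackwardSingularPoint
      (fun t : ℝ => blobSlice (Real.smoothTransition (2 * t + 2) * (Real.sqrt (-t))⁻¹)) 0 :=
  isBackwardSingularPoint_zero_of_eqOn isBackwardSingularPoint_selfSimilarBlob one_half_pos
    fun _ ht _ => gatedBlob_eq_of_lt ht

/-- **`stub_regularOfSmallSlices` minus the mild identity is FALSE.**  Drop ONLY the Oseen–Duhamel
hypothesis of stub M and keep the Type-I rate, the space–time Type-I decay, joint continuity on the open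
past slab, `div v(t) = 0` and the small-slice clause "for all `R, θ > 0` some `t̄ < 0` has
`∫_{B(0,2R√(−t̄))} |curl v(t̄)|² ≤ θ²/(4√(−t̄))`": the time-gated collapse
`t ↦ blobSlice (χ(2t+2)·(√(−t))⁻¹)` satisfies all of them (its slice at `t̄ = −1` is zero, so the clause holds
for every `R, θ`) and is backward-singular at the origin.  Hence the ε-regularity step M must use the
Navier–Stokes dynamics (as its planned proof via the Pineau–Vicol propagation does). [folklore] -/
theorem stub_regularOfSmallSlices_false_without_mild :
    ¬ ∀ (C D : ℝ) (v : ℝ → EuclideanSpace ℝ (Fin 3) → EuclideanSpace ℝ (Fin 3)),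
        HasTypeITimeDecay C v → HasTypeIDecay D v →
        ContinuousOn (uncurry v) (Iio (0 : ℝ) ×ˢ univ) →
        (∀ t < 0, VectorCalculus.IsDivFree (v t)) →
        (∀ R θ : ℝ, 0 < R → 0 < θ → ∃ tb : ℝ, tb < 0 ∧
          (∫⁻ x in ball (0 : EuclideanSpace ℝ (Fin 3)) (2 * R * Real.sqrt (-tb)),
              ENNReal.ofReal (‖curl (v tb) x‖ ^ 2)) ≤
            ENNReal.ofReal (θ ^ 2 / (4 * Real.sqrt (-tb)))) →
        ¬ IsBackwardSingularPoint v 0 := by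
  intro h
  obtain ⟨Cd, hCd0, hCd⟩ := exists_decay_biaxProfile
  refine h Cd Cd (fun t : ℝ => blobSlice (Real.smoothTransition (2 * t + 2) * (Real.sqrt (-t))⁻¹))
    ((hasTypeIDecay_gatedBlob hCd0 hCd).hasTypeITimeDecay hCd0) (hasTypeIDecay_gatedBlob hCd0 hCd)
    continuousOn_gatedBlob (fun t _ => isDivFree_blobSlice _) (fun R θ _ _ => ⟨-1, by norm_num, ?_⟩)
    isBackwardSingularPoint_gatedBlob
  have hint : (fun x : EuclideanSpace ℝ (Fin 3) => ENNReal.ofReal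
      (‖curl (blobSlice (Real.smoothTransition (2 * (-1 : ℝ) + 2) * (Real.sqrt (-(-1 : ℝ)))⁻¹)) x‖ ^ 2)) =
      fun _ => 0 := by
    funext x
    rw [curl_gatedBlob_neg_one, norm_zero, zero_pow two_ne_zero, ENNReal.ofReal_zero]
  have hzero : (∫⁻ x in ball (0 : EuclideanSpace ℝ (Fin 3)) (2 * R * Real.sqrt (-(-1 : ℝ))), ENNReal.ofReal
      (‖curl (blobSlice (Real.smoothTransition (2 * (-1 : ℝ) + 2) * (Real.sqrt (-(-1 : ℝ)))⁻¹)) x‖ ^ 2)) = 0 := by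
    rw [hint, lintegral_zero]
  exact hzero.le.trans zero_le

/-! ## §4 The BC5 rung (`stub_rung_dssSteadyPressure`) without the dynamics is false -/

/-- The self-similar collapse is exactly self-similar: `λ v(λ²t, λx) = v(t, x)` for every `λ > 0`
(`√(−λ²t) = λ√(−t)`; both sides vanish for `t ≥ 0`, where `(√(−t))⁻¹ = 0`). [folklore] -/
theorem isSelfSimilar_selfSimilarBlob : IsSelfSimilar (fun t : ℝ => blobSlice (Real.sqrt (-t))⁻¹) := by
  intro lam hlam
  show nsRescale lam (fun t : ℝ => blobSlice (Real.sqrt (-t))⁻¹) = fun t : ℝ => blobSlice (Real.sqrt (-t))⁻¹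
  funext t x
  rw [nsRescale_apply]
  show lam • ((Real.sqrt (-(lam ^ 2 * t)))⁻¹ • biaxProfile ((Real.sqrt (-(lam ^ 2 * t)))⁻¹ • (lam • x))) =
    (Real.sqrt (-t))⁻¹ • biaxProfile ((Real.sqrt (-t))⁻¹ • x)
  have h : (Real.sqrt (-(lam ^ 2 * t)))⁻¹ = lam⁻¹ * (Real.sqrt (-t))⁻¹ := by
    rw [neg_mul_eq_mul_neg, Real.sqrt_mul (sq_nonneg lam), Real.sqrt_sq hlam.le, mul_inv]
  rw [h, smul_smul, smul_smul, mul_inv_cancel_left₀ hlam.ne',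
    show lam⁻¹ * (Real.sqrt (-t))⁻¹ * lam = (Real.sqrt (-t))⁻¹ by
      rw [mul_comm, ← mul_assoc, mul_inv_cancel₀ hlam.ne', one_mul]]

/-- The self-similar collapse is `λ`-DSS for every factor `λ > 0`. [folklore] -/
theorem isDiscretelySelfSimilar_selfSimilarBlob {lam : ℝ} (hlam : 0 < lam) :
    IsDiscretelySelfSimilar lam (fun t : ℝ => blobSlice (Real.sqrt (-t))⁻¹) :=
  isSelfSimilar_selfSimilarBlob lam hlam

/-- **`stub_rung_dssSteadyPressure` minus the mild identity is FALSE**, for every factor `λ > 1` at once.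
Drop ONLY the Oseen–Duhamel hypothesis of the BC5 rung and keep `1 < λ`, the Type-I rate, the space–time
decay, joint continuity, `div v(t) = 0`, λ-DSS and the time-independent similarity pressure
`(−s)·Q[v(s)](√(−s)y) = (−t)·Q[v(t)](√(−t)y)`: the self-similar collapse of the `biaxProfile` satisfies all of
them for every `λ > 0` (`isDiscretelySelfSimilar_selfSimilarBlob`, `similarityPressure_selfSimilarBlob`) and is
backward-singular.  So even in the rung, "λ far from 1" and "steady pressure" carry no kinematic
content: the proof must use the dynamics (Tsai 1998 for the exactly self-similar case). [folklore] -/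
theorem stub_rung_dssSteadyPressure_false_without_mild :
    ¬ ∀ (C D lam : ℝ) (v : ℝ → EuclideanSpace ℝ (Fin 3) → EuclideanSpace ℝ (Fin 3)), 1 < lam →
        HasTypeITimeDecay C v → HasTypeIDecay D v →
        ContinuousOn (uncurry v) (Iio (0 : ℝ) ×ˢ univ) →
        (∀ t < 0, VectorCalculus.IsDivFree (v t)) →
        IsDiscretelySelfSimilar lam v →
        (∀ s t : ℝ, s < 0 → t < 0 → ∀ y : EuclideanSpace ℝ (Fin 3),
          (-s) * pressurePotential (v s) (Real.sqrt (-s) • y) =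
            (-t) * pressurePotential (v t) (Real.sqrt (-t) • y)) →
        ¬ IsBackwardSingularPoint v 0 := by
  intro h
  obtain ⟨Cd, hCd0, hCd⟩ := exists_decay_biaxProfile
  exact h Cd Cd 2 (fun t : ℝ => blobSlice (Real.sqrt (-t))⁻¹) one_lt_two
    ((hasTypeIDecay_selfSimilarBlob hCd).hasTypeITimeDecay hCd0) (hasTypeIDecay_selfSimilarBlob hCd)
    continuousOn_selfSimilarBlob (fun t _ => isDivFree_blobSlice _)
    (isDiscretelySelfSimilar_selfSimilarBlob two_pos)
    (fun s t hs ht y => by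
      rw [similarityPressure_selfSimilarBlob hCd hs y, similarityPressure_selfSimilarBlob hCd ht y])
    isBackwardSingularPoint_selfSimilarBlob

/-- The rung minus the mild identity stays false under EXACT self-similarity (`IsSelfSimilar`). [folklore] -/
theorem stub_rung_dssSteadyPressure_false_without_mild_selfSimilar :
    ¬ ∀ (C D : ℝ) (v : ℝ → EuclideanSpace ℝ (Fin 3) → EuclideanSpace ℝ (Fin 3)),
        HasTypeITimeDecay C v → HasTypeIDecay D v →
        ContinuousOn (uncurry v) (Iio (0 : ℝ) ×ˢ univ) →
        (∀ t < 0, VectorCalculus.IsDivFree (v t)) →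
        IsSelfSimilar v →
        (∀ s t : ℝ, s < 0 → t < 0 → ∀ y : EuclideanSpace ℝ (Fin 3),
          (-s) * pressurePotential (v s) (Real.sqrt (-s) • y) =
            (-t) * pressurePotential (v t) (Real.sqrt (-t) • y)) →
        ¬ IsBackwardSingularPoint v 0 := by
  intro h
  obtain ⟨Cd, hCd0, hCd⟩ := exists_decay_biaxProfile
  exact h Cd Cd (fun t : ℝ => blobSlice (Real.sqrt (-t))⁻¹)
    ((hasTypeIDecay_selfSimilarBlob hCd).hasTypeITimeDecay hCd0) (hasTypeIDecay_selfSimilarBlob hCd)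
    continuousOn_selfSimilarBlob (fun t _ => isDivFree_blobSlice _) isSelfSimilar_selfSimilarBlob
    (fun s t hs ht y => by
      rw [similarityPressure_selfSimilarBlob hCd hs y, similarityPressure_selfSimilarBlob hCd ht y])
    isBackwardSingularPoint_selfSimilarBlob

end Summit.NavierStokesRegularity.NavierStokesRegularity.Theorems.MonotonePressureProfileRigidity.Negative

end
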